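import Literature.Barriers.HodgeConjecture.IntegralCoefficients
import Literature.AlgebraicGeometry.Motives.ComplexPointsManifold
import Literature.AlgebraicGeometry.Motives.VarietiesQuasiCompactProofs
import Literature.AlgebraicTopology.SingularHomology.HomologySpheresProofs
import HarnessLib

/-!
# Integral coefficients: the two barrier facts against the tree's `IntegralHodgeConjectureFor`

Sibling of `Literature/Barriers/HodgeConjecture/IntegralCoefficients` (D-0021 catalogue), written
by the barrier audit of 2026-08-15. The catalogue entry's `blocks:` fields point at the tree's
`Literature.AlgebraicGeometry.Motives.BettiCycleData.IntegralHodgeConjectureFor B hX p`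
(`Motives/BettiCycleClass`: `cl_ℤ(CH_d X) = Hdg²ᵖ(X, ℤ)` relative to a hypothesis structure
`B : BettiCycleData`). This file PROVES the implication from each barrier fact to the failure of
that `Prop`, and in doing so makes the one tree-level hypothesis explicit: the fields of
`BettiCycleData` constrain the integral cycle class map `B.intCycleClass` only rationally
(`intToRat_intCycleClass`) and on smooth subvarieties (`intCycleClass_closedSubvariety`), not by
SUPPORT — nothing says that `cl_ℤ` of a `d`-cycle dies off a Zariski-closed subset of codimension
`p`, i.e. lies in `integralAlgebraicClasses X p = Nᵖ H²ᵖ(X(ℂ); ℤ)` (true for the genuine cycle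
class, Fulton 1998 §19.1; Voisin I §11.1.2). Under that support property (AH: range inside `N²`;
Kollár: range equal to `N²`, both inclusions being used) the barrier facts refute
`B.IntegralHodgeConjectureFor hX 2`:

* `AtiyahHirzebruch1962_torsionClass_notAlgebraic.exists_not_integralHodgeConjectureFor`: a
  torsion class is an integral Hodge class (`torsionClasses_le_integralHodgeClasses`), the
  Atiyah–Hirzebruch class is torsion and outside `N² H⁴`, hence outside the range of `cl_ℤ`
  [Atiyah–Hirzebruch 1962, Thm. 6.5 and Remark (3): "Hodge's conjecture is not true for
  cohomology classes of higher dimension"]. The degree bookkeeping `2 + d = dim X` needs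
  `dim X ≥ 2`, which follows from `y ≠ 0` in `H⁴(X(ℂ); ℤ)`: for `dim X ≤ 1`, `H⁴(X(ℂ); ℤ) = 0`
  (`subsingleton_bettiCohomologyInt_four_of_le_one`: `H₄ = H₃ = 0` above the real dimension,
  Hatcher Thm. 3.26 (c), and universal coefficients over `ℤ`, Hatcher Thm. 3.2 — both PROVED in
  the tree).
* `Kollar1992_nonTorsionClass_notAlgebraic.exists_not_integralHodgeConjectureFor` /
  `….not_integralHodgeConjectureFor`: `d • α ∈ N² = range cl_ℤ` is an integral Hodge class, so
  is `α` (`d ≠ 0` and Hodge classes form a `ℚ`-subspace), while `α ∉ N² = range cl_ℤ`; the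
  offending class is a NON-torsion integral Hodge class [Soulé–Voisin 2005, §2; Voisin, Hodge
  Theory I, §11.3.2 p. 235].

Everything is proved; no named facts.

## References

* [AtiyahHirzebruchTopology1962] M. F. Atiyah, F. Hirzebruch, Topology 1 (1962), Thm. 6.5,
  Remark (3) p. 43.
* [SouleVoisin2005] C. Soulé, C. Voisin, Adv. Math. 198 (2005), §2.
* [VoisinHodgeI2002] C. Voisin, Hodge Theory and Complex Algebraic Geometry I, §11.1.2, §11.3.2.
* [HatcherAT2002] A. Hatcher, Algebraic Topology, §3.1 Thm. 3.2, §3.3 Thm. 3.26.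
* [Fulton1998] W. Fulton, Intersection Theory, §19.1.
-/

noncomputable section

open CategoryTheory AlgebraicGeometry
open Literature.AlgebraicTopology.SingularHomology
open Literature.AlgebraicGeometry.Motives

namespace Literature.Barriers.HodgeConjecture

section Barriers
section HodgeConjecture

variable {n : ℕ} {X : SchemeOver ℂ}

/-- **`H⁴(X(ℂ); ℤ) = 0` for `X` smooth projective of dimension `n ≤ 1`**: `H₄(X(ℂ); ℤ) = 0` and
`H₃(X(ℂ); ℤ) = 0` (degrees above the real dimension `2n ≤ 2`, Hatcher Thm. 3.26 (c), the tree's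
`ComplexPoints.isZero_singularHomology_of_lt`), so `H⁴ ↪ Hom(H₄, ℤ) = 0` by universal
coefficients (`H₃` free; Hatcher Thm. 3.2, the tree's `injective_kroneckerMap_of_free_holds`).
[cite: HatcherAT2002, §3.1 Thm. 3.2 and §3.3 Thm. 3.26] -/
theorem subsingleton_bettiCohomologyInt_four_of_le_one (hX : IsSmoothProjective n X)
    (hn : n ≤ 1) : Subsingleton (bettiCohomologyInt X (2 * 2)) := by
  have h4 : Limits.IsZero (singularHomology ℤ ℤ (ComplexPoints X) (3 + 1)) :=
    ComplexPoints.isZero_singularHomology_of_lt hX ℤ ℤ (by omega)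
  have h3 : Limits.IsZero (singularHomology ℤ ℤ (ComplexPoints X) 3) :=
    ComplexPoints.isZero_singularHomology_of_lt hX ℤ ℤ (by omega)
  haveI : Subsingleton (singularHomology ℤ ℤ (ComplexPoints X) 3) :=
    ModuleCat.subsingleton_of_isZero h3
  have hF : Module.Free ℤ (singularHomology ℤ ℤ (ComplexPoints X) 3) := inferInstance
  exact ModuleCat.subsingleton_of_isZero (isZero_singularCohomology_of_isZero_of_free
    (injective_kroneckerMap_of_free_holds ℤ (ComplexPoints X) 3) hF h4)

/-- A non-zero class in `H⁴(X(ℂ); ℤ)` forces `dim X ≥ 2` (contrapositive of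
`subsingleton_bettiCohomologyInt_four_of_le_one`); used to produce the complementary dimension
`d` with `2 + d = dim X` in `IntegralHodgeConjectureFor`. [cite: HatcherAT2002, §3.3 Thm. 3.26] -/
theorem two_le_of_bettiCohomologyInt_four_ne_zero (hX : IsSmoothProjective n X)
    {y : bettiCohomologyInt X (2 * 2)} (hy : y ≠ 0) : 2 ≤ n := by
  by_contra h
  haveI := subsingleton_bettiCohomologyInt_four_of_le_one hX (by omega)
  exact hy (Subsingleton.elim _ _)

/-- **Atiyah–Hirzebruch ⟹ failure of the tree's integral Hodge conjecture in codimension `2`.**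
If the barrier fact `AtiyahHirzebruch1962_torsionClass_notAlgebraic` holds, then for every
`B : BettiCycleData` whose integral cycle class map has the SUPPORT PROPERTY in codimension `2`
(every `cl_ℤ(c)`, `c ∈ CH_d X`, `2 + d = dim X`, lies in `integralAlgebraicClasses X 2 = N² H⁴`;
true for the genuine cycle class, not a field of `BettiCycleData`) there is a smooth projective `X`
with `¬ B.IntegralHodgeConjectureFor hX 2`: the `2`-torsion class `y` of Thm. 6.5 is an integral
Hodge class (`torsionClasses_le_integralHodgeClasses`) outside `N² H⁴ ⊇ range cl_ℤ` ("Hodge's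
conjecture is not true for cohomology classes of higher dimension").
[cite: AtiyahHirzebruchTopology1962, Thm. 6.5 and Remark (3) p. 43] -/
theorem AtiyahHirzebruch1962_torsionClass_notAlgebraic.exists_not_integralHodgeConjectureFor
    (h : AtiyahHirzebruch1962_torsionClass_notAlgebraic) (B : BettiCycleData)
    (hB : ∀ ⦃n : ℕ⦄ ⦃X : SchemeOver ℂ⦄ (hX : IsSmoothProjective n X) ⦃d : ℕ⦄ (hd : 2 + d = n)
      (c : ChowGroup X.left d), B.intCycleClass hX hd c ∈ integralAlgebraicClasses X 2) :
    ∃ (n : ℕ) (X : SchemeOver ℂ) (hX : IsSmoothProjective n X),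
      ¬ B.IntegralHodgeConjectureFor hX 2 := by
  obtain ⟨n, X, hX, y, hy0, h2, hy⟩ := h 2 Nat.prime_two
  refine ⟨n, X, hX, fun hIHC ↦ hy ?_⟩
  have hn : 2 ≤ n := two_le_of_bettiCohomologyInt_four_ne_zero hX hy0
  obtain ⟨d, hd⟩ : ∃ d, 2 + d = n := ⟨n - 2, by omega⟩
  have hyT : y ∈ torsionClasses X (2 * 2) := by
    change IsOfFinAddOrder y
    exact isOfFinAddOrder_iff_zsmul_eq_zero.mpr ⟨2, two_ne_zero, by exact_mod_cast h2⟩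
  have hyH : y ∈ B.integralHodgeClasses hX 2 := B.torsionClasses_le_integralHodgeClasses hX 2 hyT
  rw [← hIHC hd] at hyH
  obtain ⟨c, rfl⟩ := hyH
  exact hB hX hd c

/-- **Kollár ⟹ a non-torsion integral Hodge class outside the range of `cl_ℤ`.** If the barrier
fact `Kollar1992_nonTorsionClass_notAlgebraic` holds, then for every `B : BettiCycleData` whose
integral cycle class map on smooth projective threefolds has range EXACTLY
`integralAlgebraicClasses X 2 = N² H⁴(X(ℂ); ℤ)` (the support property together with its converse
"every supported class is a `ℤ`-combination of cycle classes", Fulton Lemma 19.1.1; neither is a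
field of `BettiCycleData`) there are a smooth projective threefold `X` and a NON-torsion class
`α ∈ Hdg⁴(X, ℤ)` outside the range of `cl_ℤ`: `d • α ∈ N² = range cl_ℤ` is an integral Hodge class,
hence so is `α` (`d ≠ 0`, Hodge classes are a `ℚ`-subspace), while `α ∉ N²` — "the class `α` is of
course a Hodge class", "not algebraic, while a non-zero multiple of `α` is algebraic".
[cite: SouleVoisin2005, §2 ¶1] [cite: VoisinHodgeI2002, §11.3.2 p. 235] -/
theorem Kollar1992_nonTorsionClass_notAlgebraic.exists_not_integralHodgeConjectureFor
    (h : Kollar1992_nonTorsionClass_notAlgebraic) (B : BettiCycleData)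
    (hB : ∀ ⦃X : SchemeOver ℂ⦄ (hX : IsSmoothProjective 3 X) (hd : 2 + 1 = 3)
      (x : bettiCohomologyInt X (2 * 2)),
      x ∈ (B.intCycleClass hX hd).range ↔ x ∈ integralAlgebraicClasses X 2) :
    ∃ (X : SchemeOver ℂ) (hX : IsSmoothProjective 3 X) (α : bettiCohomologyInt X (2 * 2)),
      α ∈ B.integralHodgeClasses hX 2 ∧ (∀ m : ℤ, m • α = 0 → m = 0) ∧
        α ∉ (B.intCycleClass hX (show 2 + 1 = 3 from rfl)).range := by
  obtain ⟨X, hX, α, d, hd, hα, hdα, htf⟩ := h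
  haveI : CompactSpace X.left := IsSmoothProjective.compactSpace_holds hX
  refine ⟨X, hX, α, ?_, htf, fun hmem ↦ hα ((hB hX rfl α).mp hmem)⟩
  obtain ⟨c, hc⟩ := (hB hX rfl _).mpr hdα
  have hdH : (d : ℤ) • α ∈ B.integralHodgeClasses hX 2 :=
    hc ▸ B.intCycleClass_mem_integralHodgeClasses hX rfl c
  rw [BettiCycleData.mem_integralHodgeClasses_iff] at hdH ⊢
  rw [map_zsmul, map_zsmul] at hdH
  have hd0 : ((d : ℤ) : ℚ) ≠ 0 := by exact_mod_cast hd.ne'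
  have key := Submodule.smul_mem _ (((d : ℤ) : ℚ)⁻¹) hdH
  rwa [← Int.cast_smul_eq_zsmul ℚ, smul_smul, inv_mul_cancel₀ hd0, one_smul] at key

/-- **Kollár ⟹ failure of the tree's integral Hodge conjecture in codimension `2` on a threefold**
(for every `B : BettiCycleData` whose integral cycle class map has range exactly `N² H⁴` on smooth
projective threefolds): the non-torsion integral Hodge class `α` of
`Kollar1992_nonTorsionClass_notAlgebraic.exists_not_integralHodgeConjectureFor` is not in
`cl_ℤ(CH₁ X)`. [cite: SouleVoisin2005, §2 Thm. 2] [cite: VoisinHodgeI2002, §11.3.2 p. 235] -/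
theorem Kollar1992_nonTorsionClass_notAlgebraic.not_integralHodgeConjectureFor
    (h : Kollar1992_nonTorsionClass_notAlgebraic) (B : BettiCycleData)
    (hB : ∀ ⦃X : SchemeOver ℂ⦄ (hX : IsSmoothProjective 3 X) (hd : 2 + 1 = 3)
      (x : bettiCohomologyInt X (2 * 2)),
      x ∈ (B.intCycleClass hX hd).range ↔ x ∈ integralAlgebraicClasses X 2) :
    ∃ (X : SchemeOver ℂ) (hX : IsSmoothProjective 3 X), ¬ B.IntegralHodgeConjectureFor hX 2 := by
  obtain ⟨X, hX, α, hH, -, hα⟩ := h.exists_not_integralHodgeConjectureFor B hB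
  exact ⟨X, hX, fun hIHC ↦ hα (by rw [hIHC rfl]; exact hH)⟩

end HodgeConjecture
end Barriers

end Literature.Barriers.HodgeConjecture

end
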